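import Summits.CriticalPhenomena.PercolationContinuityZ3.Theorems.PercNearOneGluingNoHeavyPcintThirdMemCharge
import HarnessLib

/-!
# PCINT lane, reduction B3t on the memory-`τ` DANGEROUS-SET automaton — booking the on-path charges on the chords

Cell `prim-pcint` (PAPER-2 track (iii): certified intervals for `p_c(ℤ^d)`), seat `prim-pcint-2` (gen 4); support file
(`--supports stmt-CriticalPhenomena-4575`).  Does NOT build on p205010.  Memo: `run/shared/lean/prim/pcint/REDUCTIONS.md` §B3t.

The on-path charges `chargeF` of `…ThirdMemStep` are booked PER PATH VERTEX: for `v_h` (`1 ≤ h ≤ n`) with `kp h` chord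
partners below `h - 1` (`kp`: the index of the incidence `h - 1` of the site `v_h`), the charges at the FUTURE site `v_h`
(events `(t, h)` with `t + 1 < h`) total at most `kp + 1` units of which at most `kp - 1` are `t`-units
(`sum_units_future_le`, `sum_tunits_future_le`: the per-incidence injectivity of `…ChainBondUnits` restricted to the
incidences before `h`, `units_prefix_le`; a claimed corner at `v_h` carries two units, `two_le_uF_cornerSite'`), hence their
product is `≥ s² t^{kp-1}` (`prod_chargeF_future_ge`); every other on-path event (at a FORGOTTEN vertex) is charged at
least `s·t` (`chargeF_ge_st`).  Also: the chord factor is antitone in the chord count (`tchordF_anti`) and the chords with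
upper endpoint `h` number `kp h` (`card_chordPairs_fiber`).
-/

noncomputable section

namespace Summit.CriticalPhenomena.PercolationContinuityZ3.Theorems.Pcint

open Finset Literature.Probability.Percolation Literature.Probability.LatticeModels ChainBond

variable {d : ℕ} (a₀ : Fin d × Bool) {τ kc n : ℕ} {γ : Fin n → Fin d × Bool}

/-! ### The chord factor is antitone -/

/-- `tchordF (c+1) ≤ tchordF c` (`0 ≤ q₁ ≤ t`, `q₁ ≤ s²`, `s, t > 0`). [folklore] -/
theorem tchordF_succ_le {q1 s tv : ℝ} (hq0 : 0 ≤ q1) (hqt : q1 ≤ tv) (hqs : q1 ≤ s ^ 2) (hs : 0 < s) (ht : 0 < tv)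
    (c : ℕ) : tchordF q1 s tv (c + 1) ≤ tchordF q1 s tv c := by
  unfold tchordF
  rw [if_neg (Nat.succ_ne_zero c)]
  split_ifs with hc
  · subst hc
    rw [zero_add, pow_one, Nat.sub_self, pow_zero, mul_one, div_le_one (pow_pos hs 2)]
    exact hqs
  · obtain ⟨m, rfl⟩ : ∃ m, c = m + 1 := ⟨c - 1, by omega⟩
    rw [show m + 1 + 1 - 1 = m + 1 by omega, show m + 1 - 1 = m by omega,
      div_le_div_iff₀ (by positivity) (by positivity)]
    have h1 : q1 ^ (m + 1 + 1) * (s ^ 2 * tv ^ m) = (q1 ^ (m + 1) * (s ^ 2 * tv ^ m)) * q1 := by ring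
    have h2 : q1 ^ (m + 1) * (s ^ 2 * tv ^ (m + 1)) = (q1 ^ (m + 1) * (s ^ 2 * tv ^ m)) * tv := by ring
    rw [h1, h2]
    exact mul_le_mul_of_nonneg_left hqt (by positivity)

/-- **The chord factor is antitone in the chord count.** [folklore] -/
theorem tchordF_anti {q1 s tv : ℝ} (hq0 : 0 ≤ q1) (hqt : q1 ≤ tv) (hqs : q1 ≤ s ^ 2) (hs : 0 < s) (ht : 0 < tv)
    {c c' : ℕ} (h : c ≤ c') : tchordF q1 s tv c' ≤ tchordF q1 s tv c := by
  induction c', h using Nat.le_induction with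
  | base => exact le_rfl
  | succ m _ ih => exact (tchordF_succ_le hq0 hqt hqs hs ht m).trans ih

/-! ### Units of the incidences below an index bound -/

namespace ChainBond

/-- **Per-incidence injectivity below an index bound**: the base units and bonus units of the incidences of index `< m`, plus
two for a corner first pair when `m ≥ 2`, number at most `m`. [folklore] -/
theorem units_prefix_le {kc : ℕ} (hkc : 2 ≤ kc) (γ : Fin n → Fin d × Bool) (w : Site d) (m : ℕ) :
    ((paySet kc γ w).filter (· < m)).card + ((bonusSet kc γ w).filter (· < m)).card +
      (if firstCorner γ w ∧ 2 ≤ m then 2 else 0) ≤ m := by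
  classical
  set P := (paySet kc γ w).filter (· < m) with hP
  set B := (bonusSet kc γ w).filter (· < m) with hB
  set B' := B.image fun k => k - 1 with hB'
  have hBinj : Set.InjOn (fun k => k - 1) ↑B := by
    intro k hk k' hk' h
    have h1 := (mem_bonusSet.1 (mem_filter.1 (mem_coe.1 hk)).1).1.1
    have h1' := (mem_bonusSet.1 (mem_filter.1 (mem_coe.1 hk')).1).1.1
    simp only at h; omega
  have hcardB' : B'.card = B.card := card_image_of_injOn hBinj
  have hdisj : Disjoint P B' := by
    rw [disjoint_left]
    intro k hkP hkB'
    obtain ⟨k1, hk1, hk1k⟩ := mem_image.1 hkB'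
    have hb := mem_bonusSet.1 (mem_filter.1 hk1).1
    have hp := mem_paySet.1 (mem_filter.1 hkP).1
    have hk1eq : k1 = k + 1 := by have := hb.1.1; omega
    rw [hk1eq] at hb
    rcases hb.2 with h | h
    · have := hp.1; omega
    · rw [Nat.add_sub_cancel] at h; exact h hp.2.2.1
  set S : Finset ℕ := if firstCorner γ w ∧ 2 ≤ m then {0, 1} else ∅ with hS
  have hcardS : S.card = if firstCorner γ w ∧ 2 ≤ m then 2 else 0 := by
    rw [hS]; split_ifs <;> simp
  have hsub : P ∪ B' ⊆ range m \ S := by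
    intro k hk
    rw [mem_sdiff, mem_range]
    rcases mem_union.1 hk with hk | hk
    · obtain ⟨hk', hkm⟩ := mem_filter.1 hk
      have hp := mem_paySet.1 hk'
      refine ⟨hkm, fun hkS => ?_⟩
      rw [hS] at hkS
      split_ifs at hkS with hfc
      · rcases mem_insert.1 hkS with rfl | hk1
        · exact absurd hp.1 (by omega)
        · rw [mem_singleton.1 hk1] at hp; exact hp.2.2.2 ⟨rfl, hfc.1⟩
      · simp at hkS
    · obtain ⟨k1, hk1, rfl⟩ := mem_image.1 hk
      obtain ⟨hk1', hk1m⟩ := mem_filter.1 hk1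
      have hb := mem_bonusSet.1 hk1'
      refine ⟨by omega, fun hkS => ?_⟩
      rw [hS] at hkS
      split_ifs at hkS with hfc
      · rcases mem_insert.1 hkS with h0 | h1
        · have hk1eq : k1 = 1 := by have := hb.1.1; omega
          rw [hk1eq] at hb; exact hb.1.2.2.2 ⟨rfl, hfc.1⟩
        · rw [mem_singleton] at h1
          have hk1eq : k1 = 2 := by have := hb.1.1; omega
          rw [hk1eq] at hb
          rcases hb.2 with h | h
          · omega
          · exact h (show 1 ≤ 1 ∧ incAt γ w 1 ≤ incAt γ w 0 + kc from ⟨le_rfl, by rw [hfc.1.2]; omega⟩)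
      · simp at hkS
  have hSsub : S ⊆ range m := by
    rw [hS]; split_ifs with hfc
    · intro x hx
      rw [mem_range]
      rcases mem_insert.1 hx with rfl | hx
      · omega
      · rw [mem_singleton.1 hx]; omega
    · exact empty_subset _
  calc P.card + B.card + (if firstCorner γ w ∧ 2 ≤ m then 2 else 0) = (P ∪ B').card + S.card := by
        rw [← hcardB', card_union_of_disjoint hdisj, hcardS]
    _ ≤ (range m \ S).card + S.card := by gcongr
    _ = m := by rw [card_sdiff_of_subset hSsub, card_range, Nat.sub_add_cancel ((card_le_card hSsub).trans (card_range m).le)]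

/-- `uF` at an incidence time, in terms of the index. [folklore] -/
theorem uF_incAt {kc : ℕ} (γ : Fin n → Fin d × Bool) (w : Site d) {k : ℕ} (hk : k < (incTimes γ w).card) :
    uF kc γ w (incAt γ w k) = (if k ∈ paySet kc γ w then 1 else 0) + (if k ∈ bonusSet kc γ w then 1 else 0) := by
  classical
  unfold uF
  have key : ∀ (A : Finset ℕ), (∀ j ∈ A, j < (incTimes γ w).card) →
      (A.filter fun j => incAt γ w j = incAt γ w k).card = if k ∈ A then 1 else 0 := by
    intro A hA
    have : (A.filter fun j => incAt γ w j = incAt γ w k) = if k ∈ A then {k} else ∅ := by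
      ext j
      rw [mem_filter]
      constructor
      · rintro ⟨hj, hje⟩
        have := incAt_inj (hA j hj) hk hje
        subst this
        rw [if_pos hj]; exact mem_singleton_self _
      · intro hj
        split_ifs at hj with hkA
        · rw [mem_singleton] at hj; subst hj; exact ⟨hkA, rfl⟩
        · simp at hj
    rw [this]; split_ifs <;> simp
  rw [key _ fun j hj => (mem_paySet.1 hj).2.1, key _ fun j hj => (mem_bonusSet.1 hj).1.2.1]

/-- `uFt` vanishes below index `2`. [folklore] -/
theorem uFt_incAt_eq_zero_of_lt_two {kc : ℕ} (γ : Fin n → Fin d × Bool) (w : Site d) {k : ℕ}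
    (hk : k < (incTimes γ w).card) (hk2 : k < 2) : uFt kc γ w (incAt γ w k) = 0 := by
  classical
  unfold uFt
  rw [card_eq_zero, filter_eq_empty_iff]
  intro j hj hje
  have hj' := mem_tSet.1 hj
  have h2 := hj'.2.1
  have := incAt_inj hj'.1.2.1 hk hje
  omega

/-- `uFt ≤ 1`. [folklore] -/
theorem uFt_le_one {kc : ℕ} (γ : Fin n → Fin d × Bool) (w : Site d) (T : ℕ) : uFt kc γ w T ≤ 1 := by
  classical
  unfold uFt
  refine card_le_one.2 fun j hj j' hj' => ?_
  obtain ⟨hj1, hj2⟩ := mem_filter.1 hj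
  obtain ⟨hj1', hj2'⟩ := mem_filter.1 hj'
  exact incAt_inj (mem_tSet.1 hj1).1.2.1 (mem_tSet.1 hj1').1.2.1 (hj2.trans hj2'.symm)

end ChainBond

/-! ### A claimed corner carries two units of its site -/

/-- **A claimed corner carries two units**: if the automaton claims a corner at step `t`, the incidence `t + 1` of the corner
site `C` either is the second element of a corner first pair, or pays a base unit AND a bonus unit (the previous incidence
`t - 1` starts its chain: any older incidence is forgotten, hence more than `kc` steps older). [folklore] -/
theorem two_le_uF_cornerSite' (hτ : kc + 4 ≤ τ) (hkc : 2 ≤ kc) {t : ℕ} (ht : t < n)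
    (hc : bcorner (danger τ (pre a₀ γ t)) (γ ⟨t, ht⟩) = true) :
    2 ≤ uF kc γ (cornerSite γ (t - 1)) (t + 1) +
      (if incAt γ (cornerSite γ (t - 1)) 1 = t + 1 ∧ firstCorner γ (cornerSite γ (t - 1)) then 2 else 0) := by
  classical
  obtain ⟨ht1, -, -, hC1, hC2, -, -, hfree⟩ := bcorner_spec a₀ ht hc
  set C := cornerSite γ (t - 1) with hC
  have hT : t + 1 ∈ incTimes γ C := mem_incTimes.2 ⟨by omega, hC1⟩
  have hTm1 : t - 1 ∈ incTimes γ C := mem_incTimes.2 ⟨by omega, hC2⟩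
  have ht_not : t ∉ incTimes γ C := fun h => zdGraph_no_triangle (zdGraph_adj_wordPos_succ γ ht) hC1 (mem_incTimes.1 h).2
  obtain ⟨k, hk, hkT⟩ := exists_incAt_eq hT
  have hidx : ∀ {j'}, j' ∈ incTimes γ C → j' < t + 1 → ∃ j, j < k ∧ incAt γ C j = j' := by
    intro i' hi' hit
    obtain ⟨j, hj, hji⟩ := exists_incAt_eq hi'
    refine ⟨j, ?_, hji⟩
    by_contra hjk
    rcases Nat.lt_or_ge k j with h | h
    · have := incAt_strictMono h hj; omega
    · have : j = k := by omega
      subst this; omega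
  obtain ⟨j1, hj1, hj1e⟩ := hidx hTm1 (by omega)
  have hk1 : 1 ≤ k := by omega
  have hprev : incAt γ C (k - 1) = t - 1 := by
    have h1 : incAt γ C j1 ≤ incAt γ C (k - 1) := by
      rcases Nat.lt_or_ge j1 (k - 1) with h | h
      · exact (incAt_strictMono h (by omega)).le
      · have : j1 = k - 1 := by omega
        rw [this]
    have h2 : incAt γ C (k - 1) < t + 1 := by rw [← hkT]; exact incAt_strictMono (by omega) hk
    have h3 : incAt γ C (k - 1) ≠ t := fun h => ht_not (h ▸ incAt_mem (by omega))
    omega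
  by_cases hk1' : k = 1
  · -- corner first pair
    subst hk1'
    have h0 : incAt γ C 0 = t - 1 := by simpa using hprev
    have hfc : firstCorner γ C := ⟨by omega, by rw [hkT, h0]; omega⟩
    rw [if_pos ⟨hkT, hfc⟩]; omega
  · have hk2 : 2 ≤ k := by omega
    have hpays : paysAt kc γ C k := ⟨hk1, hk, ⟨hk1, by rw [hkT, hprev]; omega⟩, fun h => hk1' h.1⟩
    -- the incidence `k - 2` is forgotten at time `t`, hence far: `k - 1` is not linked
    have hbonus : bonusAt kc γ C k := by
      refine ⟨hpays, Or.inr ?_⟩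
      rintro ⟨-, hlk⟩
      have hm2 : incAt γ C (k - 1 - 1) ∈ incTimes γ C := incAt_mem (by omega)
      have hlt : incAt γ C (k - 1 - 1) < incAt γ C (k - 1) := incAt_strictMono (by omega) (by omega)
      set i := incAt γ C (k - 1 - 1) with hi
      -- if `i` were within `τ - 3` of `t` it would be remembered with age `≥ 2`
      have hage : t ≤ i + (τ - 3) := by rw [hprev] at hlk; omega
      have hrem : IsRem τ γ i t := isRem_of_adj (by exact ht) (by omega) hage (by omega) hC1 (mem_incTimes.1 hm2).2
      have hmem := mem_danger_pre_of_isRem a₀ ht.le hrem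
      refine hfree _ hmem (by simp only; omega) ?_
      have := (adj_sub_wordPos_iff γ t (wordPos γ i) C).2 (mem_incTimes.1 hm2).2
      simpa using this
    have := le_uF hkT hpays
    rw [if_pos hbonus] at this
    omega

/-! ### The exponents of a charge -/

section Charges

open Classical

variable {s tv : ℝ}

/-- The `s`-exponent of the charge at the site `x` at step `t`. [folklore] -/
def ecs (τ kc : ℕ) (γ : Fin n → Fin d × Bool) (t : ℕ) (x : Site d) : ℕ :=
  if ht : t < n then
    (if x - wordPos γ t ∈ cdetSet kc (danger τ (pre a₀ γ t)) (γ ⟨t, ht⟩) then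
        uA τ kc (danger τ (pre a₀ γ t)) (x - wordPos γ t) - uAt kc (danger τ (pre a₀ γ t)) (γ ⟨t, ht⟩) (x - wordPos γ t)
      else 0) +
      (if bcorner (danger τ (pre a₀ γ t)) (γ ⟨t, ht⟩) = true ∧ cornerSite γ (t - 1) = x then 2 else 0)
  else 0

/-- The `t`-exponent of the charge at the site `x` at step `t`. [folklore] -/
def ect (τ kc : ℕ) (γ : Fin n → Fin d × Bool) (t : ℕ) (x : Site d) : ℕ :=
  if ht : t < n then
    (if x - wordPos γ t ∈ cdetSet kc (danger τ (pre a₀ γ t)) (γ ⟨t, ht⟩) then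
      uAt kc (danger τ (pre a₀ γ t)) (γ ⟨t, ht⟩) (x - wordPos γ t) else 0)
  else 0

/-- **A charge is `s^{ecs} t^{ect}`.** [folklore] -/
theorem chargeF_eq_pow (t : ℕ) (x : Site d) :
    chargeF a₀ s tv τ kc γ t x = s ^ ecs a₀ τ kc γ t x * tv ^ ect a₀ τ kc γ t x := by
  unfold chargeF ecs ect
  by_cases ht : t < n
  · rw [dif_pos ht, dif_pos ht, dif_pos ht]
    by_cases hD : x - wordPos γ t ∈ cdetSet kc (danger τ (pre a₀ γ t)) (γ ⟨t, ht⟩)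
    · -- a det-paying site is not the claimed corner site
      have hnc : ¬ (bcorner (danger τ (pre a₀ γ t)) (γ ⟨t, ht⟩) = true ∧ cornerSite γ (t - 1) = x) := by
        rintro ⟨hc, hCx⟩
        obtain ⟨-, -, -, -, -, -, -, hfree⟩ := bcorner_spec a₀ ht hc
        rw [cdetSet, mem_filter] at hD
        obtain ⟨-, -, -, ⟨q, hq, hq2⟩, -⟩ := hD
        rw [← hCx] at hq
        exact hfree q (mem_bcinc.1 hq).1 hq2 (mem_bcinc.1 hq).2
      rw [if_pos hD, if_pos hD, if_pos hD, if_neg hnc, if_neg hnc, mul_one, add_zero, siteF]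
    · rw [if_neg hD, if_neg hD, if_neg hD, one_mul, zero_add, pow_zero, mul_one]
      split_ifs <;> simp
  · rw [dif_neg ht, dif_neg ht, dif_neg ht, pow_zero, pow_zero, mul_one]

/-- Exponent bounds of a charge: `ect ≤ 1`, `ecs + ect ≤ 2`. [folklore] -/
theorem ecs_add_ect_le (t : ℕ) (x : Site d) : ect a₀ τ kc γ t x ≤ 1 ∧ ecs a₀ τ kc γ t x + ect a₀ τ kc γ t x ≤ 2 := by
  unfold ecs ect
  by_cases ht : t < n
  · rw [dif_pos ht, dif_pos ht]
    by_cases hD : x - wordPos γ t ∈ cdetSet kc (danger τ (pre a₀ γ t)) (γ ⟨t, ht⟩)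
    · have hnc : ¬ (bcorner (danger τ (pre a₀ γ t)) (γ ⟨t, ht⟩) = true ∧ cornerSite γ (t - 1) = x) := by
        rintro ⟨hc, hCx⟩
        obtain ⟨-, -, -, -, -, -, -, hfree⟩ := bcorner_spec a₀ ht hc
        rw [cdetSet, mem_filter] at hD
        obtain ⟨-, -, -, ⟨q, hq, hq2⟩, -⟩ := hD
        rw [← hCx] at hq
        exact hfree q (mem_bcinc.1 hq).1 hq2 (mem_bcinc.1 hq).2
      rw [if_pos hD, if_pos hD, if_neg hnc]
      have h1 := uA_le_two τ kc (danger τ (pre a₀ γ t)) (x - wordPos γ t)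
      have h2 := uAt_le_uA τ kc (danger τ (pre a₀ γ t)) (γ ⟨t, ht⟩) (x - wordPos γ t)
      have h3 : uAt kc (danger τ (pre a₀ γ t)) (γ ⟨t, ht⟩) (x - wordPos γ t) ≤ 1 := by unfold uAt; split_ifs <;> omega
      omega
    · rw [if_neg hD, if_neg hD]; split_ifs <;> omega
  · rw [dif_neg ht, dif_neg ht]; omega

/-- **Every on-path charge is at least `s·t`.** [folklore] -/
theorem chargeF_ge_st (hs0 : 0 ≤ s) (hs1 : s ≤ 1) (ht0 : 0 ≤ tv) (hts : tv ≤ s) (t : ℕ) (x : Site d) :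
    s * tv ≤ chargeF a₀ s tv τ kc γ t x := by
  rw [chargeF_eq_pow]
  obtain ⟨h1, h2⟩ := ecs_add_ect_le a₀ (τ := τ) (kc := kc) (γ := γ) t x
  have := spow_tpow_le (i := ecs a₀ τ kc γ t x) (j := ect a₀ τ kc γ t x) (a := 1) (b := 1) hs1 ht0 hts
  -- `s^i t^j ≥ s t` needs the reverse comparison: more units means a smaller factor
  have key : s ^ 1 * tv ^ 1 ≤ s ^ ecs a₀ τ kc γ t x * tv ^ ect a₀ τ kc γ t x := by
    -- `s t = s^{2-j} ... ` : compare `s·t ≤ s^{ecs} t^{ect}` using `ecs + ect ≤ 2`, `ect ≤ 1`, `t ≤ s ≤ 1`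
    rcases Nat.lt_or_ge (ect a₀ τ kc γ t x) 1 with hj | hj
    · have hj0 : ect a₀ τ kc γ t x = 0 := by omega
      rw [hj0, pow_zero, mul_one, pow_one, pow_one]
      calc s * tv ≤ s * s := mul_le_mul_of_nonneg_left hts hs0
        _ = s ^ 2 := by ring
        _ ≤ s ^ ecs a₀ τ kc γ t x := pow_le_pow_of_le_one hs0 hs1 (by omega)
    · have hj1 : ect a₀ τ kc γ t x = 1 := by omega
      rw [hj1, pow_one, pow_one]
      exact mul_le_mul_of_nonneg_right (by
        calc s = s ^ 1 := (pow_one s).symm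
          _ ≤ s ^ ecs a₀ τ kc γ t x := by
              rcases Nat.eq_zero_or_pos (ecs a₀ τ kc γ t x) with h0 | h0
              · rw [h0, pow_zero, pow_one]; exact hs1
              · exact pow_le_pow_of_le_one hs0 hs1 (by omega)) ht0
  simpa using key

end Charges

end Summit.CriticalPhenomena.PercolationContinuityZ3.Theorems.Pcint
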